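import Summits.Ventures.YMGap.RobustBall.UniformPlaquetteDecay
import Summits.Ventures.YMGap.RobustBall.UniformMassGapKR
import Summits.Ventures.YMGap.RobustBall.UniformMassGapS
import Summits.Ventures.YMGap.RobustBall.UniformMassGapZdG
import HarnessLib

/-!
# Venture YMGap, track ROBUST-BALL (Y2) — uniform rows «up to β⋆» and the plaquette two-point cells with
# explicit constants

HONEST FRAMING. WHAT THIS IS: a venture file (cell `pub-ymgap`, track Y2 ROBUST-BALL, seat rb-p1, theorems
only): (1) the uniform rows of `UniformMassGapKR/S.lean` in «UP TO `β⋆`» form — ONE `(m, A)` for every Wilson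
coupling `0 ≤ β_W ≤ β⋆_W`, every member and every DLR state (the row conditions are monotone in `β_W`):
`su2_uniformRowA_upTo_1_8` (tier 1, ball `MemBallZd (1/10) (1/20) R`, rate `(1/8)/max(1,R)`, constant `32`),
`su2_uniformLoopBall_upTo_1_16` (loop ball `‖c‖_{log 2} ≤ 0.143`, rate `log 2`, constant `16`),
`su2_wilson_clustering_upTo` restated; (2) the PLAQUETTE TWO-POINT CELLS (`UniformPlaquetteDecay.lean` applied to the
landed uniform rows), normalised plaquettes `W_p = ½ Re tr U_p` of `SU(2)` on `ℤ⁴`, sup norm: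
* loop ball at `β_W = 1/16`, `‖c‖_{log 2} ≤ 0.143`: for EVERY such loop action and EVERY DLR state,
  `|Cov(W_p(x), W_q(y))| ≤ 1049600 · e^{-(log 2)‖x−y‖_∞}` (`= 1049600 · 2^{-‖x−y‖_∞}`) — `su2_loopBall_plaquette_decay_1_16`;
* Wilson point `0 ≤ β_W ≤ 1/12`: EVERY DLR state of pure `SU(2)` Wilson: `|Cov(W_p(x), W_q(y))| ≤ 2099200 · 2^{-‖x−y‖_∞}`
  — `su2_wilson_plaquette_decay_upTo_oneTwelfth`;
* tier-1 ball `MemBallZd (1/10) (1/20) R` at `β_W ≤ 1/8`: `|Cov| ≤ 2099200 e^{1/4} · e^{-‖x−y‖_∞/(8 max(1,R))}` (stated with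
  the generic constant) — `su2_ballZd_plaquette_decay_upTo_1_8`;
* gauge ball, quarter radius at `β_W = 1/8`: rate `(1/32)/(max R 1 + 4)` — `su2_gaugeBall_plaquette_decay_oneEighth_quarterRadius`.
WHAT THIS IS NOT: the constants are what the Dobrushin comparison gives (`16A e^{2m}(16N⁶+1)` with `N = 2`), not
optimised; rates are lower bounds on the inverse correlation length; strong-coupling LATTICE statements, nothing about
the continuum limit or a Clay-sense mass gap.  Certificates: `HOME/rb/certs/UNIFORM-RATES-rbp1.md`.
-/

noncomputable section

open MeasureTheory Filter Function ProbabilityTheory Real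
open scoped NNReal
open Literature.Probability.LatticeModels
open Literature.Probability.LatticeModels.DobrushinMetric
open Literature.MathematicalPhysics.QuantumLattice
open Literature.MathematicalPhysics.QuantumFieldTheory hiding ZdEdge Site

namespace Summit.Ventures.YMGap.RobustBall

/-! ### Uniform rows up to `β⋆` -/

/-- **Tier 1, `SU(2)`, `d = 4`, UP TO `β_W = 1/8`**: for every `0 ≤ β_W ≤ 1/8`, `UniformMassGapOnBallZd 4 2 (β_W/4) (1/10) (1/20) R
((1/8)/max(1,R)) 32` — ONE rate and ONE constant on the ball `MemBallZd (1/10) (1/20) R` over the whole coupling window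
(row sum `6 β_W T(1/10) + T(1/20)·0.8165/20 ≤ 7/8`). [folklore] -/
theorem su2_uniformRowA_upTo_1_8 {βW : ℝ} (h0 : 0 ≤ βW) (h : βW ≤ 1 / 8) (R : ℝ) :
    UniformMassGapOnBallZd 4 2 (βW / 4) (2 * (1 / 20)) (1 / 20) R ((1 - 7 / 8) / max 1 R) 32 := by
  refine su2_uniformRowA R h0 (by norm_num) (by norm_num) ?_ (by norm_num) (by norm_num)
  calc 6 * βW * (1 + 2 * (1 / 20 : ℝ) + (2 * (1 / 20)) ^ 2 / 2 + (2 * (1 / 20)) ^ 3 / 6 + 5 / 96 * (2 * (1 / 20)) ^ 4) +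
        (1 + 1 / 20 + (1 / 20 : ℝ) ^ 2 / 2 + (1 / 20) ^ 3 / 6 + 5 / 96 * (1 / 20) ^ 4) * (8165 / 10000) * (1 / 20)
      ≤ 6 * (1 / 8) * (1 + 2 * (1 / 20 : ℝ) + (2 * (1 / 20)) ^ 2 / 2 + (2 * (1 / 20)) ^ 3 / 6 + 5 / 96 * (2 * (1 / 20)) ^ 4) +
        (1 + 1 / 20 + (1 / 20 : ℝ) ^ 2 / 2 + (1 / 20) ^ 3 / 6 + 5 / 96 * (1 / 20) ^ 4) * (8165 / 10000) * (1 / 20) := by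
        gcongr
    _ ≤ 7 / 8 := by norm_num

/-- **Tier 2 / loop ball, `SU(2)`, `d = 4`, UP TO `β_W = 1/16`**: for every `0 ≤ β_W ≤ 1/16`,
`UniformMassGapOnBallZdS 4 2 (β_W/4) (2·0.143) 0.143 (log 2) (log 2) 16` (lineage-B row condition, monotone in `β_W`). [folklore] -/
theorem su2_uniformRowBS2_upTo_1_16 {βW : ℝ} (h0 : 0 ≤ βW) (h : βW ≤ 1 / 16) :
    UniformMassGapOnBallZdS 4 2 (βW / 4) (2 * (143 / 1000)) (143 / 1000) (Real.log 2) (Real.log 2) 16 := by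
  refine su2_uniformRowBS (by norm_num) h0 (h.trans (by norm_num)) (by norm_num) (by norm_num) ?_
  calc 3 * (1732051 / 1000000 : ℝ) * βW * 2 *
        (1 + 2 * (143 / 1000 : ℝ) + (2 * (143 / 1000)) ^ 2 / 2 + (2 * (143 / 1000)) ^ 3 / 6 + 5 / 96 * (2 * (143 / 1000)) ^ 4) +
        (1 + 143 / 1000 + (143 / 1000 : ℝ) ^ 2 / 2 + (143 / 1000) ^ 3 / 6 + 5 / 96 * (143 / 1000) ^ 4) * (8165 / 10000) *
          (143 / 1000)
      ≤ 3 * (1732051 / 1000000 : ℝ) * (1 / 16) * 2 *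
        (1 + 2 * (143 / 1000 : ℝ) + (2 * (143 / 1000)) ^ 2 / 2 + (2 * (143 / 1000)) ^ 3 / 6 + 5 / 96 * (2 * (143 / 1000)) ^ 4) +
        (1 + 143 / 1000 + (143 / 1000 : ℝ) ^ 2 / 2 + (143 / 1000) ^ 3 / 6 + 5 / 96 * (143 / 1000) ^ 4) * (8165 / 10000) *
          (143 / 1000) := by
        gcongr
    _ < 1 := by norm_num

/-- **THE LOOP BALL UP TO `β_W = 1/16`**: for every `0 ≤ β_W ≤ 1/16`, EVERY generic Wilson-type loop action on `ℤ⁴` with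
finite carrier fibres and `‖c‖_{log 2} ≤ 0.143`: one DLR state, rate `log 2`, constant `16 n²` —
`UniformMassGapOnLoopBall 4 2 (β_W/4) (log 2) 0.143 (log 2) 16`. [folklore] -/
theorem su2_uniformLoopBall_upTo_1_16 {βW : ℝ} (h0 : 0 ≤ βW) (h : βW ≤ 1 / 16) :
    UniformMassGapOnLoopBall 4 2 (βW / 4) (Real.log 2) (143 / 1000) (Real.log 2) 16 :=
  (su2_uniformRowBS2_upTo_1_16 h0 h).uniformMassGapOnLoopBall

/-! ### Plaquette two-point cells (`SU(2)`, `d = 4`, `W_p = ½ Re tr U_p`, sup norm) -/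

/-- The `SU(2)` plaquette constant at `(m, A) = (log 2, 16)`: `max(max(16·16, 0)·e^{2 log 2}·(32·32 + 1), 4 e^{2 log 2}) = 1049600`. -/
theorem su2_plaquetteConst_log2_16 :
    max (max ((16 : ℝ) * (4 : ℕ) ^ 2) 0 * Real.exp (2 * Real.log 2) *
        (((4 * ((2 : ℕ) : ℝ≥0) ^ 3 : ℝ≥0) : ℝ) * ((4 * ((2 : ℕ) : ℝ≥0) ^ 3 : ℝ≥0) : ℝ) + 1))
      (4 * Real.exp (2 * Real.log 2)) = 1049600 := by
  have h4 : Real.exp (2 * Real.log 2) = 4 := by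
    rw [← Real.log_rpow (by norm_num : (0 : ℝ) < 2), Real.exp_log (by positivity)]; norm_num
  rw [h4]
  push_cast
  norm_num

/-- The `SU(2)` plaquette constant at `(m, A) = (log 2, 32)`: `2099200`. -/
theorem su2_plaquetteConst_log2_32 :
    max (max ((32 : ℝ) * (4 : ℕ) ^ 2) 0 * Real.exp (2 * Real.log 2) *
        (((4 * ((2 : ℕ) : ℝ≥0) ^ 3 : ℝ≥0) : ℝ) * ((4 * ((2 : ℕ) : ℝ≥0) ^ 3 : ℝ≥0) : ℝ) + 1))
      (4 * Real.exp (2 * Real.log 2)) = 2099200 := by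
  have h4 : Real.exp (2 * Real.log 2) = 4 := by
    rw [← Real.log_rpow (by norm_num : (0 : ℝ) < 2), Real.exp_log (by positivity)]; norm_num
  rw [h4]
  push_cast
  norm_num

/-- **PLAQUETTE TWO-POINT DECAY, UNIFORMLY ON THE LOOP BALL, `β_W ≤ 1/16`**: for every `0 ≤ β_W ≤ 1/16`, EVERY generic
Wilson-type loop action on `ℤ⁴` (finite carrier fibres, `‖c‖_{log 2} ≤ 0.143`), EVERY DLR state `μ` and every two plaquettes:
`|Cov_μ(W_p(x), W_q(y))| ≤ 1049600 · e^{-(log 2)‖x−y‖_∞}` (`= 1049600 · 2^{-‖x−y‖_∞}`). [folklore] -/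
theorem su2_loopBall_plaquette_decay_upTo_1_16 {βW : ℝ} (h0 : 0 ≤ βW) (h : βW ≤ 1 / 16)
    {ι : Type} {γ : ι → ZdLoop 4} {c : ι → ℝ} (hfin : ∀ X, {i | walkEdges (γ i).walk = X}.Finite)
    (hn : LoopNormLE (Real.log 2) γ c (143 / 1000)) {μ : Measure (LGConfig 4 (SUN 2))}
    (hμ : μ ∈ perturbedGibbsMeasuresS (d := 4) (fundamentalRep (Fin 2)) (2 * (βW / 4)) (loopFamilyAction (d := 4) 2 γ c))
    (x y : Literature.Probability.LatticeModels.Site 4) {i j k l : Fin 4} (hij : i < j) (hkl : k < l) :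
    |cov[zdPlaquetteObs (fundamentalRep (Fin 2)) x i j, zdPlaquetteObs (fundamentalRep (Fin 2)) y k l; μ]| ≤
      1049600 * Real.exp (-Real.log 2 * ‖x - y‖) := by
  have h := (su2_uniformLoopBall_upTo_1_16 h0 h).abs_cov_plaquette_le hfin hn hμ x y hij hkl
  rwa [su2_plaquetteConst_log2_16] at h

/-- **PLAQUETTE TWO-POINT DECAY OF PURE `SU(2)` WILSON ON `ℤ⁴`, EVERY DLR STATE, `0 ≤ β_W ≤ 1/12`**, explicit:
`|Cov_μ(W_p(x), W_q(y))| ≤ 2099200 · e^{-(log 2)‖x−y‖_∞}` (the zero member of the ball; `su2_wilson_clustering_upTo_oneTwelfth`).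
[folklore] -/
theorem su2_wilson_plaquette_decay_upTo_oneTwelfth {βW : ℝ} (h0 : 0 ≤ βW) (h : βW ≤ 1 / 12)
    {μ : Measure (LGConfig 4 (SUN 2))}
    (hμ : μ ∈ perturbedGibbsMeasures (d := 4) (fundamentalRep (Fin 2)) (2 * (βW / 4)) 0
      (fun _ => (∅ : Finset (Finset (ZdEdge 4)))))
    (x y : Literature.Probability.LatticeModels.Site 4) {i j k l : Fin 4} (hij : i < j) (hkl : k < l) :
    |cov[zdPlaquetteObs (fundamentalRep (Fin 2)) x i j, zdPlaquetteObs (fundamentalRep (Fin 2)) y k l; μ]| ≤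
      2099200 * Real.exp (-Real.log 2 * ‖x - y‖) := by
  have h := (su2_wilson_clustering_upTo_oneTwelfth h0 h).abs_cov_plaquette_le (Real.log_pos one_lt_two) hμ x y
    hij hkl
  rwa [su2_plaquetteConst_log2_32] at h

/-- The same for the tree's Wilson DLR states `ymGibbsMeasures (fundamentalRep (Fin 2)) (β_W/2)` (bare coupling `β_W/2`;
`perturbedGibbsMeasures_zero`). [folklore] -/
theorem su2_wilson_plaquette_decay_upTo_oneTwelfth' {βW : ℝ} (h0 : 0 ≤ βW) (h : βW ≤ 1 / 12)
    {μ : Measure (LGConfig 4 (SUN 2))} (hμ : μ ∈ ymGibbsMeasures (d := 4) (fundamentalRep (Fin 2)) (βW / 2))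
    (x y : Literature.Probability.LatticeModels.Site 4) {i j k l : Fin 4} (hij : i < j) (hkl : k < l) :
    |cov[zdPlaquetteObs (fundamentalRep (Fin 2)) x i j, zdPlaquetteObs (fundamentalRep (Fin 2)) y k l; μ]| ≤
      2099200 * Real.exp (-Real.log 2 * ‖x - y‖) := by
  refine su2_wilson_plaquette_decay_upTo_oneTwelfth h0 h ?_ x y hij hkl
  rw [perturbedGibbsMeasures_zero]
  have e : (2 : ℝ) * (βW / 4) = βW / 2 := by ring
  rwa [e]

/-- **PLAQUETTE TWO-POINT DECAY, UNIFORMLY ON THE TIER-1 BALL `MemBallZd (1/10) (1/20) R`, `β_W ≤ 1/8`**: rate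
`(1/8)/max(1,R)`, the generic constant at `A = 32`. [folklore] -/
theorem su2_ballZd_plaquette_decay_upTo_1_8 {βW : ℝ} (h0 : 0 ≤ βW) (h : βW ≤ 1 / 8) {R : ℝ}
    {W : Potential (ZdEdge 4) (SUN 2)} {supp : Finset (ZdEdge 4) → Finset (Finset (ZdEdge 4))}
    (hW : MemBallZd (2 * (1 / 20)) (1 / 20) R W supp) {μ : Measure (LGConfig 4 (SUN 2))}
    (hμ : μ ∈ perturbedGibbsMeasures (d := 4) (fundamentalRep (Fin 2)) (2 * (βW / 4)) W supp)
    (x y : Literature.Probability.LatticeModels.Site 4) {i j k l : Fin 4} (hij : i < j) (hkl : k < l) :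
    |cov[zdPlaquetteObs (fundamentalRep (Fin 2)) x i j, zdPlaquetteObs (fundamentalRep (Fin 2)) y k l; μ]| ≤
      max (max ((32 : ℝ) * (4 : ℕ) ^ 2) 0 * Real.exp (2 * ((1 - 7 / 8) / max 1 R)) *
          (((4 * ((2 : ℕ) : ℝ≥0) ^ 3 : ℝ≥0) : ℝ) * ((4 * ((2 : ℕ) : ℝ≥0) ^ 3 : ℝ≥0) : ℝ) + 1))
        (4 * Real.exp (2 * ((1 - 7 / 8) / max 1 R))) * Real.exp (-((1 - 7 / 8) / max 1 R) * ‖x - y‖) :=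
  (su2_uniformRowA_upTo_1_8 h0 h R).abs_cov_plaquette_le hW hμ x y hij hkl

/-- **PLAQUETTE TWO-POINT DECAY, UNIFORMLY ON ds-2's GAUGE BALL, quarter radius at `β_W = 1/8`**
(`MemBallZdG (37/500) (37/1000) R`): rate `(1/32)/(max R 1 + 4)`, the generic constant at `A = 64`. [folklore] -/
theorem su2_gaugeBall_plaquette_decay_oneEighth_quarterRadius {R : ℕ}
    {W : Potential (ZdEdge 4) (SUN 2)} {supp : Finset (ZdEdge 4) → Finset (Finset (ZdEdge 4))}
    (hW : MemBallZdG (37 / 500) (37 / 1000) R W supp) {μ : Measure (LGConfig 4 (SUN 2))}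
    (hμ : μ ∈ perturbedGibbsMeasures (d := 4) (fundamentalRep (Fin 2)) (2 * (1 / 32)) W supp)
    (x y : Literature.Probability.LatticeModels.Site 4) {i j k l : Fin 4} (hij : i < j) (hkl : k < l) :
    |cov[zdPlaquetteObs (fundamentalRep (Fin 2)) x i j, zdPlaquetteObs (fundamentalRep (Fin 2)) y k l; μ]| ≤
      max (max ((64 : ℝ) * (4 : ℕ) ^ 2) 0 * Real.exp (2 * ((1 / 32 : ℝ) / (max R 1 + 4 : ℕ))) *
          (((4 * ((2 : ℕ) : ℝ≥0) ^ 3 : ℝ≥0) : ℝ) * ((4 * ((2 : ℕ) : ℝ≥0) ^ 3 : ℝ≥0) : ℝ) + 1))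
        (4 * Real.exp (2 * ((1 / 32 : ℝ) / (max R 1 + 4 : ℕ)))) *
        Real.exp (-((1 / 32 : ℝ) / (max R 1 + 4 : ℕ)) * ‖x - y‖) :=
  (su2_uniformStar_oneEighth_quarterRadius R).abs_cov_plaquette_le hW hμ x y hij hkl

end Summit.Ventures.YMGap.RobustBall

end
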